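import Summits.QuantumFields.YangMills.Theorems.BalabanUVNodesPortS1Sect5AtRecordF1Pkg

/-!
# NODE O port, row PT-A-2 S5-B — [Balaban1987RG1] §5 (5.11)–(5.26) (momentum representation, polystrip analyticity, permutation ∕ reflection laws, the Laurent form (5.26)) and the
# transversal Ward form, AT THE RE-CENTRED RECORD: the JOIN of the lineage's generic theorems (`B12Momentum511`, `B12Rep526Coeff`, packaged in `B12Carve25Sect5TensorHyp.Hyp`) at
# `Π := recordPlimAx F a₀ ε₂₉ k v`, from the F1′ rows at `(k, v)` + (5.10)

CITATION HEADER.  [I] = [Balaban1987RG1]: (5.10)–(5.16) p. 293, (5.17)–(5.26) pp. 294–295.  Porter PT-A-2 (`ymgap-nodeO-port-PTA-2`), `--supports stmt-QuantumFields-27930 --as helper`.  REUSED BY NAME: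
`carve25Hyp_recordPlimAx_of_rows₂'` (the bundle at the record, F1′ rows), `B12Carve25Sect5TensorHyp.Hyp.{analytic511, eq512, eq513, eq526, wardTransversal}`.
WHAT IS PROVED (0 sorry, 0 def): ★ `sect5B_recordPlimAx_of_rows₂'` — for the record's limiting kernel: (5.11) every component's momentum representation `Π̃_{μν}` is analytic on the polystrip
`{|Im ζ_μ| < δ₁}`; (5.12) the permutation law; (5.13) the reflection law; (5.26) the Laurent representation on every polyring `b < δ₁`; and the transversal Ward form — one conjunction.
DISPLAYED ROWS: the νD-rows of `sect5_recordPlimAx_of_rows₂'`, `PolLimitExists`, `C²` at `0`, (5.10) `Decay510` with constants `C, δ₁ > 0`.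
HONEST FRAMING.  One-line JOINs (the port-lead's S5-B row); nothing of Bałaban's estimates asserted, ported or discharged ((5.10) is displayed); 27930 signed-open (⁸-Ax-LR4), no claim held; finite 𝕋⁴
at fixed ε — NOT continuum∕OS∕Clay; the Yang–Mills mass gap is NOT proved by any of this.
-/

noncomputable section

open scoped Matrix.Norms.L2Operator Topology BigOperators

namespace Summit.QuantumFields.YangMills.Theorems.BalabanUVNodesPortS1

open Filter MeasureTheory
open Literature.MathematicalPhysics.QuantumFieldTheory.Balaban1983to89
open Literature.MathematicalPhysics.QuantumFieldTheory.Balaban1983to89.Node00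
open Literature.MathematicalPhysics.QuantumFieldTheory.Balaban1983to89.ExpMeanLog (deltaSU)
open T4Continuum (T4Family)
open Literature.MathematicalPhysics.QuantumFieldTheory.GawedzkiKupiainen1985.PeriodicGleason (Pt PolyAnnulus)
open Summit.QuantumFields.YangMills.Theorems.K0RecordFormatNames
open B12PolarizationTensor120 (expChart polComp)
open B12Transverse536 (WardFirst ReflCovariant)
open Beta.PolarizationSign (IndexSymmetric)
open B12Sec2to5 (Decay510)
open FederbushMean (deltaFed)
open GaugeField (gaugeAct)

variable (F : T4Family) (a₀ ε₂₉ : ℝ) (νD : Stage7Numerics)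

/-- **★ (5.11), (5.12), (5.13), (5.26) AND THE TRANSVERSAL WARD FORM FOR `recordPlimAx F a₀ ε₂₉ k v`** from the F1′ rows + (5.10): the JOIN of `B12Carve25Sect5TensorHyp.Hyp`'s consequences at the
record's bundle `carve25Hyp_recordPlimAx_of_rows₂'`. [cite: Balaban1987RG1, (5.11)-(5.13) p.293, (5.26) p.295, (5.9) p.293] -/
theorem sect5B_recordPlimAx_of_rows₂' (k : ℕ) (v : Fin (k + 1) → ℝ) {C δ₁ : ℝ} (hδ : 0 < δ₁)
    (h510 : ∀ μ ν : Fin 4, Decay510 (recordPlimAx F a₀ ε₂₉ k v μ ν) C δ₁)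
    (hε₀ : 0 < νD.ε₀) (hεreg : 0 < (thetaFill F a₀ ε₂₉).ν.εreg) (hεbg : 0 < (thetaFill F a₀ ε₂₉).εbg)
    (hlim : letI θ := thetaFill F a₀ ε₂₉
      letI := θ.instVβ₁; letI := θ.instVβ₂; letI := θ.instιβ
      PolLimitExists F (k + 1) (fun K => recordTermsAx F a₀ ε₂₉ k v K) θ.ρ8 θ.bV)
    (hC2 : letI θ := thetaFill F a₀ ε₂₉
      letI := θ.instVβ₁; letI := θ.instVβ₂
      ∀ᶠ K in atTop, ContDiffAt ℝ 2 (expChart (recordTermsAx F a₀ ε₂₉ k v K) θ.ρ8) 0)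
    (hrows : letI θ := thetaFill F a₀ ε₂₉
      ∀ᶠ K in atTop, k + 1 ≤ K ∧
        (((((F.P K).d * (F.P K).L : ℕ) : ℝ)) ^ 2 / 4 * νD.ε₀ < deltaFed (Fin 2) ∧
          (143 * (((((F.P K).d + 4 : ℕ) : ℝ)) ^ 2 / 4) ^ 2) * θ.ν.εreg ≤ 1 / 3 ∧
          2 * θ.ν.εreg ≤ 2 * deltaSU (Fin 2) / ((((F.P K).d + 4) * (F.P K).L : ℕ) : ℝ) ^ 2 ∧ 2 * θ.ν.εreg ≤ νD.ε₀ * ((F.P K).L : ℝ) ^ 2 ∧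
          (143 * (((((F.P K).d + 4 : ℕ) : ℝ)) ^ 2 / 4) ^ 2) * θ.εbg ≤ 1 / 3 ∧
          2 * θ.εbg ≤ 2 * deltaSU (Fin 2) / ((((F.P K).d + 4) * (F.P K).L : ℕ) : ℝ) ^ 2 ∧ 2 * θ.εbg ≤ νD.ε₀ * ((F.P K).L : ℝ) ^ 2) ∧
        (∀ j < k + 1, ∀ W ∈ domAltOfRecord F 2 νD K (j + 1), UkExists F 2 K (j + 1) θ.ν.εreg W ∧ UniqueUkOrbit F 2 K (j + 1) θ.ν.εreg W) ∧
        (∀ j < k + 1, domAltOfRecord F 2 νD K (j + 1) ⊆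
          regSetOfRecord F 2 K j (betaInputOfRecord F 2 (TβOfRecord₁₃ F 2) (chiβOfRecord₁₃Ax F 2 θ) K (T4FlagMemory.extd v) j)) ∧
        (∀ j < k + 1, ∀ᵐ U ∂(fieldMeasure (F.P K) j (SU 2)), (avOfRecord F 2 K j).avg U ∈ domAltOfRecord F 2 νD K (j + 1) →
          U ∉ domAltOfRecord F 2 νD K j → chiβOfRecord₁₃Ax F 2 θ K (T4FlagMemory.extd v) j U = 0) ∧
        (∀ j < k + 1, Integrable (betaInputOfRecord F 2 (TβOfRecord₁₃ F 2) (chiβOfRecord₁₃Ax F 2 θ) K (T4FlagMemory.extd v) j) (fieldMeasure (F.P K) j (SU 2))) ∧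
        (∀ W ∈ domAltOfRecord F 2 νD K (k + 1), UkExists F 2 K (k + 1) θ.εbg W ∧ UniqueUkOrbit F 2 K (k + 1) θ.εbg W)) :
    (∀ μ ν : Fin 4, AnalyticOnNhd ℂ (B12Momentum511.piT (B12Rep537.ofReal (recordPlimAx F a₀ ε₂₉ k v μ ν))) (B12Momentum511.PolyStrip 4 δ₁)) ∧
    (∀ (r : Equiv.Perm (Fin 4)) (μ ν : Fin 4) (ζ : Fin 4 → ℂ),
      B12Momentum511.piT (B12Rep526Coeff.castK (recordPlimAx F a₀ ε₂₉ k v) μ ν) (B12Rep526.permZ r ζ)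
        = B12Momentum511.piT (B12Rep526Coeff.castK (recordPlimAx F a₀ ε₂₉ k v) (r.symm μ) (r.symm ν)) ζ) ∧
    (∀ (μ ν : Fin 4) (ε : Fin 4 → ℤˣ) (ζ : Fin 4 → ℂ),
      B12Momentum511.piT (B12Rep526Coeff.castK (recordPlimAx F a₀ ε₂₉ k v) μ ν) (fun κ => ((ε κ : ℤ) : ℂ) * ζ κ)
        = B12Rep526.sgn (ε μ) * B12Rep526.sgn (ε ν)
            * (Complex.exp (-(Complex.I * ((1 - ((ε μ : ℤ) : ℂ)) / 2 * ζ μ))) * Complex.exp (Complex.I * ((1 - ((ε ν : ℤ) : ℂ)) / 2 * ζ ν)))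
            * B12Momentum511.piT (B12Rep526Coeff.castK (recordPlimAx F a₀ ε₂₉ k v) μ ν) ζ) ∧
    (∀ (μ ν : Fin 4) {b : ℝ}, b < δ₁ → ∀ {z : Fin 4 → ℂ}, z ∈ PolyAnnulus 4 b →
      B12Rep526Coeff.f529 (B12Rep526Coeff.castK (recordPlimAx F a₀ ε₂₉ k v)) μ ν z
        = B12Rep526.rep526 (B12Rep526Coeff.gRep (B12Rep526Coeff.castK (recordPlimAx F a₀ ε₂₉ k v))) μ ν z) ∧
    Beta.PolarizationSign.WardTransversal (recordPlimAx F a₀ ε₂₉ k v) := by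
  have h := carve25Hyp_recordPlimAx_of_rows₂' F a₀ ε₂₉ νD (fun _ : Unit => k) (fun _ => v) hδ (fun _ => h510) hε₀ hεreg hεbg
    (fun _ => hlim) (fun _ => hC2) (fun _ => hrows)
  exact ⟨fun μ ν => h.analytic511 () μ ν, fun r μ ν ζ => h.eq512 () r μ ν ζ, fun μ ν ε ζ => h.eq513 () μ ν ε ζ,
    fun μ ν b hb z hz => h.eq526 () μ ν hb hz, h.wardTransversal ()⟩

end Summit.QuantumFields.YangMills.Theorems.BalabanUVNodesPortS1

end
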